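import Summits.SmoothPoincare4.SmoothPoincare4.Theorems.ConvexBisectionAcyclicBisectionExistsSplitComplement
import Summits.SmoothPoincare4.SmoothPoincare4.Theorems.ConvexBisectionAcyclicBisectionExistsDualHandleBeltMap
import Literature.Topology.FourManifolds.HandleAttachingMapOfTube
import Literature.Topology.FourManifolds.AttachingMapBoundaryTube
import Literature.Topology.FourManifolds.CollarTheorem
import Literature.Topology.FourManifolds.HandleAttachingMapsTransport
import Literature.Topology.FourManifolds.PresentationHandlebodyFiveProofs
import Literature.Geometry.Symplectic.TwoHandleIsotopyHolds
import HarnessLib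

/-!
# Dual handles, III: plumbing — the dual attaching maps of a multi-attachment on the other piece
# of a gluing, the dual word, Lefschetz links at arbitrary directions
(brick (A) of the sub-goal T3b "the complement of the prefix sub-handlebody is the other piece with
the DUAL suffix handles" of stub `stub_steinRealisation` (NF6), line `modp-braid-orbits` r11, crux
`ConvexBisection.AcyclicBisectionExists`, item stmt-SmoothPoincare4-10508; wave 2, lead c5; this is
the PROVED §0 of the published design file `T3_DualHandles_Design.lean`, landed verbatim)

Sequel of `…DualHandleSwap.lean` / `…DualHandleBeltMap.lean` (`beltMap D j : HandleAttachingMap 3 2 X`,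
the belt tube of the `j`-th handle of `X = B ∪_{h̄} (handles)`, attaching circle = belt circle).
For a gluing `M = X ∪_Ψ W` (`Ψ : ∂X ≅ ∂W` between boundary data `bX`, `bW`):

* `CircleTube.mapDiffeo` — a tube around a circle in a 3-manifold pushed through a
  diffeomorphism (`G ∘ Φ`);
* `seamDiffeo bX bW Ψ : ∂X ≅ ∂W` — the seam diffeomorphism on the CANONICAL boundary carriers
  (`BoundaryManifold.boundaryData 3 _`), by `BoundaryData.restrictDiffeomorph` (Lee 2013, Thm. 5.11);
* `pushedTubeData`, `pushedMap q₀ G col κ δ : HandleAttachingMap 3 2 W` — the boundary tube of an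
  attaching map `q₀` of `X` pushed through `G : ∂X ≅ ∂W` and prolonged along a collar `col` of
  `∂W` (`TubeAttachData.attachingMap`, Kosinski 1993 III §4, VI §6), `attachingCircle_pushedMap`;
* **`dualMap D bX bW Ψ col κ δ j : HandleAttachingMap 3 2 W`** — THE DUAL ATTACHING MAP of the
  `j`-th handle on `W`: the pushed belt map (Milnor 1965 §3: the dual handle is attached along the
  belt sphere); `attachingCircle_dualMap` (the dual attaching circle is `Ψ` of the belt circle),
  `incl_mem_coresComplement_dualMap` (the old seam, off the belt circles, is off the dual cores),
  `disjoint_range_natAdd_castAdd` (prefix/suffix bookkeeping);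
* `dualWord N A flip` (+ `length_dualWord`, `get_dualWord`, `dualWord_forall_ne_zero`,
  `dualWord_forall_sign`) — the dual word (the predicates `IsLefschetzLinkAt`, `ClockwiseDirs` of
  the design file are T3c vocabulary and are left to the T3c bricks);
* `helper_attachingCircle_dualMap` (registered) — `attachingCircle_dualMap` in tree vocabulary.

Everything here is proved; no named facts.

## References
* J. Milnor, *Lectures on the h-cobordism theorem* (1965), §3 (dual handles). [MilnorHCobordism1965]
* A. A. Kosinski, *Differential Manifolds* (1993), III (3.1), III §4, VI §6, VI §8, VII §1. [Kosinski1993]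
* R. E. Gompf, A. I. Stipsicz, *4-Manifolds and Kirby Calculus* (1999), §8.2 pp. 289–291. [GompfStipsicz1999]
* R. İ. Baykur, *Kähler decomposition of 4-manifolds*, AGT 6 (2006), proof of Thm. 5.1. [Baykur2006]
* J. M. Lee, *Introduction to Smooth Manifolds* (2013), Thm. 5.11. [LeeSmoothManifolds2013]
-/

noncomputable section

-- the prescribed namespace `Summit.<P>.<Sub>.…` duplicates `SmoothPoincare4` (P = Sub)
set_option linter.dupNamespace false

open scoped Manifold ContDiff Topology

namespace Summit.SmoothPoincare4.SmoothPoincare4.Theorems.AcyclicBisectionExists.ModpBraidOrbits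

open Set Function Filter Metric Topology
open Literature.Topology.FourManifolds Literature.Topology.FourManifolds.HandleAttachingMap
  Literature.Topology.FourManifolds.LefschetzBase Literature.Geometry.Symplectic

/-! ## §0 Plumbing (everything in this section is PROVED) -/

section Plumbing

/-! ### §0.1 Pushing a tube through a diffeomorphism of 3-manifolds -/

/-- **A tube around a circle pushed through a diffeomorphism of 3-manifolds**: `G ∘ Φ`.
[cite: Kosinski1993, III (3.1)] -/
def _root_.Literature.Topology.FourManifolds.CircleTube.mapDiffeo
    {Y Y' : Type*} [TopologicalSpace Y] [ChartedSpace (EuclideanSpace ℝ (Fin 3)) Y]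
    [TopologicalSpace Y'] [ChartedSpace (EuclideanSpace ℝ (Fin 3)) Y']
    (Φ : CircleTube Y) (G : Y ≃ₘ⟮𝓡 3, 𝓡 3⟯ Y') : CircleTube Y' where
  toHomeo := Φ.toHomeo.transHomeomorph G.toHomeomorph
  source_eq := by rw [OpenPartialHomeomorph.transHomeomorph_source, Φ.source_eq]
  contMDiffOn_toHomeo := by
    rw [OpenPartialHomeomorph.transHomeomorph_source, OpenPartialHomeomorph.transHomeomorph_apply]
    exact G.contMDiff.comp_contMDiffOn Φ.contMDiffOn_toHomeo
  contMDiffOn_symm := by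
    rw [OpenPartialHomeomorph.transHomeomorph_target, OpenPartialHomeomorph.transHomeomorph_symm_apply]
    exact Φ.contMDiffOn_symm.comp G.symm.contMDiff.contMDiffOn fun _ hp => hp

/-- The pushed tube on points. [folklore] -/
@[simp] theorem _root_.Literature.Topology.FourManifolds.CircleTube.mapDiffeo_apply
    {Y Y' : Type*} [TopologicalSpace Y] [ChartedSpace (EuclideanSpace ℝ (Fin 3)) Y]
    [TopologicalSpace Y'] [ChartedSpace (EuclideanSpace ℝ (Fin 3)) Y']
    (Φ : CircleTube Y) (G : Y ≃ₘ⟮𝓡 3, 𝓡 3⟯ Y') (q : (sphere (0 : EuclideanSpace ℝ (Fin 2)) 1) × EuclideanSpace ℝ (Fin 2)) :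
    (Φ.mapDiffeo G).toHomeo q = G (Φ.toHomeo q) := by
  show (Φ.toHomeo.transHomeomorph G.toHomeomorph) q = _
  rw [OpenPartialHomeomorph.transHomeomorph_apply]; rfl

/-- The source of the pushed tube. [folklore] -/
theorem _root_.Literature.Topology.FourManifolds.CircleTube.mapDiffeo_source
    {Y Y' : Type*} [TopologicalSpace Y] [ChartedSpace (EuclideanSpace ℝ (Fin 3)) Y]
    [TopologicalSpace Y'] [ChartedSpace (EuclideanSpace ℝ (Fin 3)) Y']
    (Φ : CircleTube Y) (G : Y ≃ₘ⟮𝓡 3, 𝓡 3⟯ Y') : (Φ.mapDiffeo G).toHomeo.source = Φ.toHomeo.source :=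
  OpenPartialHomeomorph.transHomeomorph_source _ _

/-! ### §0.2 The seam diffeomorphism on the canonical boundary carriers -/

variable {X : Type} [TopologicalSpace X] [ChartedSpace (EuclideanHalfSpace 4) X] [IsManifold (𝓡∂ 4) ∞ X]
  {W : Type} [TopologicalSpace W] [ChartedSpace (EuclideanHalfSpace 4) W] [IsManifold (𝓡∂ 4) ∞ W]

/-- **The seam diffeomorphism `∂X ≅ ∂W` on the CANONICAL boundary carriers** (the subtypes
`(𝓡∂ 4).boundary X`, `(𝓡∂ 4).boundary W` of `BoundaryManifold.boundaryData`), obtained from a gluing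
diffeomorphism `Ψ : bX.carrier ≅ bW.carrier` between arbitrary boundary data by restricting the identity
(`BoundaryData.restrictDiffeomorph`, Lee 2013 Thm. 5.11). [cite: LeeSmoothManifolds2013, Thm. 5.11] -/
def seamDiffeo (bX : BoundaryData (𝓡∂ 4) X (𝓡 3)) (bW : BoundaryData (𝓡∂ 4) W (𝓡 3))
    (Ψ : bX.carrier ≃ₘ⟮𝓡 3, 𝓡 3⟯ bW.carrier) :
    (BoundaryManifold.boundaryData 3 X).carrier ≃ₘ⟮𝓡 3, 𝓡 3⟯ (BoundaryManifold.boundaryData 3 W).carrier :=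
  (((BoundaryManifold.boundaryData 3 X).restrictDiffeomorph bX (Diffeomorph.refl (𝓡∂ 4) X ∞)).trans Ψ).trans
    (bW.restrictDiffeomorph (BoundaryManifold.boundaryData 3 W) (Diffeomorph.refl (𝓡∂ 4) W ∞))

/-- **The seam diffeomorphism on points**: `seamDiffeo y = bW.incl (Ψ z)` for the `z` with
`bX.incl z = y`. [folklore] -/
theorem coe_seamDiffeo (bX : BoundaryData (𝓡∂ 4) X (𝓡 3)) (bW : BoundaryData (𝓡∂ 4) W (𝓡 3))
    (Ψ : bX.carrier ≃ₘ⟮𝓡 3, 𝓡 3⟯ bW.carrier) (y : (BoundaryManifold.boundaryData 3 X).carrier) :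
    (BoundaryManifold.boundaryData 3 W).incl (seamDiffeo bX bW Ψ y) =
      bW.incl (Ψ ((BoundaryManifold.boundaryData 3 X).restrictDiffeomorph bX (Diffeomorph.refl (𝓡∂ 4) X ∞) y)) := by
  show (BoundaryManifold.boundaryData 3 W).incl
      (bW.restrictDiffeomorph (BoundaryManifold.boundaryData 3 W) (Diffeomorph.refl (𝓡∂ 4) W ∞) (Ψ _)) = _
  rw [BoundaryData.incl_restrictDiffeomorph]
  rfl

/-- The restriction of the identity relates the two boundary inclusions: `bX.incl (∂(id) y) = y`.
[folklore] -/
theorem incl_restrict_refl (bX : BoundaryData (𝓡∂ 4) X (𝓡 3)) (y : (BoundaryManifold.boundaryData 3 X).carrier) :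
    bX.incl ((BoundaryManifold.boundaryData 3 X).restrictDiffeomorph bX (Diffeomorph.refl (𝓡∂ 4) X ∞) y) =
      (BoundaryManifold.boundaryData 3 X).incl y := by
  rw [BoundaryData.incl_restrictDiffeomorph]; rfl

/-! ### §0.3 An attaching map pushed through a boundary diffeomorphism and re-prolonged along a collar -/

/-- **Data for the pushed attaching map**: the boundary tube of `q₀ : T → X` (`q₀.boundaryTube`, a
tube in `∂X`) pushed through `G : ∂X ≅ ∂W`, a collar of `∂W`, and scales `0 < κ ≤ 1`, `0 < δ ≤ 1/2`.
[cite: Kosinski1993, III §4 and VI §6] -/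
def pushedTubeData (q₀ : HandleAttachingMap 3 2 X)
    (G : (BoundaryManifold.boundaryData 3 X).carrier ≃ₘ⟮𝓡 3, 𝓡 3⟯ (BoundaryManifold.boundaryData 3 W).carrier)
    (col : (BoundaryManifold.boundaryData 3 W).Collar) (κ δ : ℝ) (hκ : 0 < κ) (hκ1 : κ ≤ 1) (hδ : 0 < δ)
    (hδ2 : δ ≤ 1 / 2) : TubeAttachData W where
  tube := (q₀.boundaryTube.mapDiffeo G).toHomeo
  ε := 1
  source_eq := (q₀.boundaryTube.mapDiffeo G).source_eq
  smooth := (q₀.boundaryTube.mapDiffeo G).contMDiffOn_toHomeo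
  smooth_symm := (q₀.boundaryTube.mapDiffeo G).contMDiffOn_symm
  col := col
  κ := κ
  δ := δ
  κ_pos := hκ
  κ_le := hκ1
  δ_pos := hδ
  δ_le := hδ2

/-- **The pushed attaching map** `W ⊇ col (G (q₀-tube of ∂X), height)`: the boundary germ of `q₀`
transplanted to `W` through `G : ∂X ≅ ∂W` (`TubeAttachData.attachingMap`: a smooth embedding `T → W`
with open range sending `T ∩ ∂D⁴` into `∂W`). [cite: Kosinski1993, III §4 and VI §6] -/
def pushedMap (q₀ : HandleAttachingMap 3 2 X)
    (G : (BoundaryManifold.boundaryData 3 X).carrier ≃ₘ⟮𝓡 3, 𝓡 3⟯ (BoundaryManifold.boundaryData 3 W).carrier)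
    (col : (BoundaryManifold.boundaryData 3 W).Collar) (κ δ : ℝ) (hκ : 0 < κ) (hκ1 : κ ≤ 1) (hδ : 0 < δ)
    (hδ2 : δ ≤ 1 / 2) : HandleAttachingMap 3 2 W :=
  (pushedTubeData q₀ G col κ δ hκ hκ1 hδ hδ2).attachingMap

/-- **The attaching circle of the pushed map is `G` of the attaching circle of `q₀`.**
[cite: Kosinski1993, VI §6] -/
theorem attachingCircle_pushedMap (q₀ : HandleAttachingMap 3 2 X)
    (G : (BoundaryManifold.boundaryData 3 X).carrier ≃ₘ⟮𝓡 3, 𝓡 3⟯ (BoundaryManifold.boundaryData 3 W).carrier)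
    (col : (BoundaryManifold.boundaryData 3 W).Collar) (κ δ : ℝ) (hκ : 0 < κ) (hκ1 : κ ≤ 1) (hδ : 0 < δ)
    (hδ2 : δ ≤ 1 / 2) (θ : sphere (0 : EuclideanSpace ℝ (Fin 2)) 1) :
    (pushedMap q₀ G col κ δ hκ hκ1 hδ hδ2).attachingCircle θ =
      (BoundaryManifold.boundaryData 3 W).incl
        (G (⟨q₀.attachingCircle θ, q₀.isBoundaryPoint_attachingCircle θ⟩ : ↥((𝓡∂ 4).boundary X))) := by
  rw [pushedMap, TubeAttachData.attachingCircle_attachingMap]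
  show (BoundaryManifold.boundaryData 3 W).incl ((q₀.boundaryTube.mapDiffeo G).toHomeo (θ, 0)) = _
  rw [CircleTube.mapDiffeo_apply]
  congr 2
  apply Subtype.ext
  exact q₀.coe_boundaryTube_core θ

/-! ### §0.4 The dual attaching maps of a multi-attachment glued to `W` -/

variable {B : Type} [TopologicalSpace B] [T2Space B] [ChartedSpace (EuclideanHalfSpace 4) B]
  {ι : Type} [Finite ι] {h : ι → HandleAttachingMap 3 2 B}

/-- **THE DUAL ATTACHING MAP of the `j`-th handle of `X = B ∪_{h̄} (handles)` on the other piece `W`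
of a gluing `M = X ∪_Ψ W`**: the belt tube of the handle (`beltMap D j`, landed p134936) read in `∂X`,
pushed through the seam diffeomorphism `Ψ` and prolonged along the collar `col` of `∂W` (Milnor 1965
§3: the dual handle is attached along the image of the belt sphere; Kosinski 1993 VI §6: attaching
map = tubular neighbourhood in the boundary prolonged by a collar). [cite: MilnorHCobordism1965, §3] -/
def dualMap (D : MultiAttachmentData h (𝓡∂ 4) X) (bX : BoundaryData (𝓡∂ 4) X (𝓡 3))
    (bW : BoundaryData (𝓡∂ 4) W (𝓡 3)) (Ψ : bX.carrier ≃ₘ⟮𝓡 3, 𝓡 3⟯ bW.carrier)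
    (col : (BoundaryManifold.boundaryData 3 W).Collar) (κ δ : ℝ) (hκ : 0 < κ) (hκ1 : κ ≤ 1) (hδ : 0 < δ)
    (hδ2 : δ ≤ 1 / 2) (j : ι) : HandleAttachingMap 3 2 W :=
  pushedMap (beltMap D j) (seamDiffeo bX bW Ψ) col κ δ hκ hκ1 hδ hδ2

/-- **The dual attaching circle is `Ψ` of the belt circle**: for the `z` with
`bX.incl z = D.jB j (0, 0, θ)`, `(dualMap … j).attachingCircle θ = bW.incl (Ψ z)`.
[cite: MilnorHCobordism1965, §3] -/
theorem attachingCircle_dualMap (D : MultiAttachmentData h (𝓡∂ 4) X) (bX : BoundaryData (𝓡∂ 4) X (𝓡 3))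
    (bW : BoundaryData (𝓡∂ 4) W (𝓡 3)) (Ψ : bX.carrier ≃ₘ⟮𝓡 3, 𝓡 3⟯ bW.carrier)
    (col : (BoundaryManifold.boundaryData 3 W).Collar) (κ δ : ℝ) (hκ : 0 < κ) (hκ1 : κ ≤ 1) (hδ : 0 < δ)
    (hδ2 : δ ≤ 1 / 2) (j : ι) (θ : sphere (0 : EuclideanSpace ℝ (Fin 2)) 1) :
    ∃ z : bX.carrier, bX.incl z = D.jB j (beltCirclePt θ) ∧
      (dualMap D bX bW Ψ col κ δ hκ hκ1 hδ hδ2 j).attachingCircle θ = bW.incl (Ψ z) := by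
  refine ⟨(BoundaryManifold.boundaryData 3 X).restrictDiffeomorph bX (Diffeomorph.refl (𝓡∂ 4) X ∞)
    (⟨(beltMap D j).attachingCircle θ, (beltMap D j).isBoundaryPoint_attachingCircle θ⟩ :
      ↥((𝓡∂ 4).boundary X)), ?_, ?_⟩
  · rw [incl_restrict_refl]; rfl
  · rw [dualMap, attachingCircle_pushedMap, coe_seamDiffeo]

/-- **The old seam, off the belt circles, lies off the dual cores**: if `D.jA a = bX.incl z` then
`bW.incl (Ψ z)` is not on any dual attaching circle (the dual attaching circles are `Ψ` of the belt
circles, `attachingCircle_dualMap`, and belt-circle points are glued to nothing,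
`jA_ne_jB_beltCirclePt`). [cite: Kosinski1993, VI §6] -/
theorem incl_mem_coresComplement_dualMap [T2Space W] (D : MultiAttachmentData h (𝓡∂ 4) X)
    (bX : BoundaryData (𝓡∂ 4) X (𝓡 3)) (bW : BoundaryData (𝓡∂ 4) W (𝓡 3))
    (Ψ : bX.carrier ≃ₘ⟮𝓡 3, 𝓡 3⟯ bW.carrier) (col : (BoundaryManifold.boundaryData 3 W).Collar)
    (κ δ : ℝ) (hκ : 0 < κ) (hκ1 : κ ≤ 1) (hδ : 0 < δ) (hδ2 : δ ≤ 1 / 2)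
    {ι' : Type} [Finite ι'] (f : ι' → ι) (z : bX.carrier) (a : ↥(coresComplement h))
    (hz : D.jA a = bX.incl z) :
    bW.incl (Ψ z) ∈ coresComplement (fun j : ι' => dualMap D bX bW Ψ col κ δ hκ hκ1 hδ hδ2 (f j)) := by
  rw [mem_coresComplement]
  intro j hj
  rw [← range_attachingCircle] at hj
  obtain ⟨θ, hθ⟩ := hj
  obtain ⟨z', hz', hcirc⟩ := attachingCircle_dualMap D bX bW Ψ col κ δ hκ hκ1 hδ hδ2 (f j) θ
  rw [hcirc] at hθ
  have hzz : z' = z := Ψ.injective (bW.injective_incl hθ)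
  subst hzz
  exact jA_ne_jB_beltCirclePt D (f j) a θ (hz.trans hz')

/-- The prefix/suffix attaching maps of a multi-attachment have disjoint ranges (bookkeeping for
`MultiAttachmentData.lift`; indices as in `helper_isMultiAttachment_split_append`). [folklore] -/
theorem disjoint_range_natAdd_castAdd {m n k : ℕ} (hk : k = m + n) {h : Fin k → HandleAttachingMap 3 2 B}
    {P₀ : Type*} [TopologicalSpace P₀] [ChartedSpace (EuclideanHalfSpace 4) P₀]
    (D : MultiAttachmentData h (𝓡∂ 4) P₀) (j : Fin n) (i : Fin m) :
    Disjoint (range (h (Fin.cast hk.symm (Fin.natAdd m j))).toFun)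
      (range (h (Fin.cast hk.symm (Fin.castAdd n i))).toFun) :=
  D.disjoint fun e => by
    have := congrArg Fin.val e
    simp at this
    omega

/-! ### §0.5 The dual word -/

/-- **The dual word**: letterwise, the class pushed through an automorphism `A j` of `ℤ^{2g}` and the
sign flipped iff `flip` (uniformly).  For `N` all-negative and `flip = true` this is the positive word
`Ā(N̄)` of Baykur's `−X₋`. [cite: Baykur2006, Thm. 5.1 (proof, p. 13)] -/
def dualWord {g : ℕ} (N : List ((Fin g ⊕ Fin g → ℤ) × Bool))
    (A : Fin N.length → ((Fin g ⊕ Fin g → ℤ) ≃ₗ[ℤ] (Fin g ⊕ Fin g → ℤ))) (flip : Bool) :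
    List ((Fin g ⊕ Fin g → ℤ) × Bool) :=
  List.ofFn fun j : Fin N.length => (A j (N.get j).1, xor flip (N.get j).2)

/-- The dual word has the length of the word. [folklore] -/
@[simp] theorem length_dualWord {g : ℕ} (N : List ((Fin g ⊕ Fin g → ℤ) × Bool))
    (A : Fin N.length → ((Fin g ⊕ Fin g → ℤ) ≃ₗ[ℤ] (Fin g ⊕ Fin g → ℤ))) (flip : Bool) :
    (dualWord N A flip).length = N.length := by
  simp [dualWord]

/-- The letters of the dual word. [folklore] -/
theorem get_dualWord {g : ℕ} (N : List ((Fin g ⊕ Fin g → ℤ) × Bool))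
    (A : Fin N.length → ((Fin g ⊕ Fin g → ℤ) ≃ₗ[ℤ] (Fin g ⊕ Fin g → ℤ))) (flip : Bool)
    (j : Fin (dualWord N A flip).length) :
    (dualWord N A flip).get j =
      (A (Fin.cast (length_dualWord N A flip) j) (N.get (Fin.cast (length_dualWord N A flip) j)).1,
        xor flip (N.get (Fin.cast (length_dualWord N A flip) j)).2) := by
  simp [dualWord]
  rfl

/-- **The classes of the dual word are non-zero if those of the word are** (automorphisms are
injective). [folklore] -/
theorem dualWord_forall_ne_zero {g : ℕ} (N : List ((Fin g ⊕ Fin g → ℤ) × Bool))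
    (A : Fin N.length → ((Fin g ⊕ Fin g → ℤ) ≃ₗ[ℤ] (Fin g ⊕ Fin g → ℤ))) (flip : Bool)
    (hN : ∀ x ∈ N, x.1 ≠ 0) : ∀ x ∈ dualWord N A flip, x.1 ≠ 0 := by
  intro x hx
  obtain ⟨j, rfl⟩ := List.mem_iff_get.1 hx
  rw [get_dualWord]
  intro h0
  exact hN _ (List.get_mem N _) ((A _).map_eq_zero_iff.1 h0)

/-- **The signs of the dual word are uniform on a uniformly signed word**: if all letters of `N` have
sign `b` then all letters of the dual word have sign `xor flip b`. [folklore] -/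
theorem dualWord_forall_sign {g : ℕ} (N : List ((Fin g ⊕ Fin g → ℤ) × Bool))
    (A : Fin N.length → ((Fin g ⊕ Fin g → ℤ) ≃ₗ[ℤ] (Fin g ⊕ Fin g → ℤ))) (flip b : Bool)
    (hN : ∀ x ∈ N, x.2 = b) : ∀ x ∈ dualWord N A flip, x.2 = xor flip b := by
  intro x hx
  obtain ⟨j, rfl⟩ := List.mem_iff_get.1 hx
  rw [get_dualWord, hN _ (List.get_mem N _)]

end Plumbing

/-! ### The registered helper -/

/-- **Registered helper `helper_attachingCircle_dualMap` (brick (A) of T3b, sub-goal of NF6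
`stub_steinRealisation`, wave 2, lead c5): the dual attaching circle is `Ψ` of the belt circle.**
For a multi-attachment `X = B ∪_{h̄} (handles)` with data `D`, boundary data `bX`, `bW` of `X`, `W`,
a diffeomorphism `Ψ : ∂X ≅ ∂W`, a collar `col` of `∂W` and scales `κ`, `δ`: for every handle `j` and
angle `θ` there is `z ∈ ∂X` over the belt-circle point `D.jB j (0, 0, θ)` with
`(dualMap … j).attachingCircle θ = bW.incl (Ψ z)` (Milnor 1965 §3: the dual handle is attached along
the image of the belt sphere). [cite: MilnorHCobordism1965, §3] -/
theorem helper_attachingCircle_dualMap : ∀ {B : Type} [TopologicalSpace B] [T2Space B] [ChartedSpace (EuclideanHalfSpace 4) B] {ι : Type} [Finite ι] {h : ι → Literature.Topology.FourManifolds.HandleAttachingMap 3 2 B} {X : Type} [TopologicalSpace X] [ChartedSpace (EuclideanHalfSpace 4) X] [IsManifold (𝓡∂ 4) ∞ X] {W : Type} [TopologicalSpace W] [ChartedSpace (EuclideanHalfSpace 4) W] [IsManifold (𝓡∂ 4) ∞ W] (D : Literature.Topology.FourManifolds.HandleAttachingMap.MultiAttachmentData h (𝓡∂ 4) X) (bX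 : Literature.Topology.FourManifolds.BoundaryData (𝓡∂ 4) X (𝓡 3)) (bW : Literature.Topology.FourManifolds.BoundaryData (𝓡∂ 4) W (𝓡 3)) (Ψ : bX.carrier ≃ₘ⟮𝓡 3, 𝓡 3⟯ bW.carrier) (col : (Literature.Topology.FourManifolds.BoundaryManifold.boundaryData 3 W).Collar) (κ δ : ℝ) (hκ : 0 < κ) (hκ1 : κ ≤ 1) (hδ : 0 < δ) (hδ2 : δ ≤ 1 / 2) (j : ι) (θ : Metric.sphere (0 : EuclideanSpace ℝ (Fin 2)) 1), ∃ z : bX.carrier, bX.incl z = D.jB j (Summit.SmoothPoincare4.SmoothPoincare4.Theorems.AcyclicBisectionExists.ModpBraidOrbits.beltCirclePt θ) ∧ (Summit.SmoothPoincare4.SmoothPoincare4.Theorems.AcyclicBisectionExists.ModpBraidOrbits.dualMap D bX bW Ψ col κ δ hκ hκ1 hδ hδ2 j).attachingCircle θ = bW.incl (Ψ z) :=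
  fun D bX bW Ψ col κ δ hκ hκ1 hδ hδ2 j θ => attachingCircle_dualMap D bX bW Ψ col κ δ hκ hκ1 hδ hδ2 j θ

end Summit.SmoothPoincare4.SmoothPoincare4.Theorems.AcyclicBisectionExists.ModpBraidOrbits

end
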